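import Mathlib
import Literature.MathematicalPhysics.StatisticalMechanics.Crystallization
import Literature.MathematicalPhysics.StatisticalMechanics.CrystallizationSymmetries
import Literature.MathematicalPhysics.StatisticalMechanics.CrystallizationLocalLimit
import Literature.MathematicalPhysics.StatisticalMechanics.LennardJonesClusters
import Literature.MathematicalPhysics.StatisticalMechanics.StickyChain
import Summits.AtomisticToContinuum.Crystallization.Theorems.ThreeConeCertificateExactCertificateTransfer1D
import Summits.AtomisticToContinuum.Crystallization.Theorems.ThreeConeCertificateExactCertificateTransfer1DEnergetic
import Summits.AtomisticToContinuum.Crystallization.Theorems.ThreeConeCertificateExactCertificateTransfer1DChainEnergy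
import Summits.AtomisticToContinuum.Crystallization.Theorems.ThreeConeCertificateExactCertificateTransfer1DLineSort
import Summits.AtomisticToContinuum.Crystallization.Theorems.ThreeConeCertificateExactCertificateTransfer1DBlockMatching
import Summits.AtomisticToContinuum.Crystallization.Theorems.ThreeConeCertificateExactCertificateTransfer1DGoodBlock
import Summits.AtomisticToContinuum.Crystallization.Theorems.ThreeConeCertificateExactCertificateTransfer1DLJConvex
import Summits.AtomisticToContinuum.Crystallization.Theorems.ThreeConeCertificateExactCertificateTransfer1DBudget
import Summits.AtomisticToContinuum.Crystallization.Theorems.ThreeConeCertificateExactCertificateTransfer1DMinGap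
import Summits.AtomisticToContinuum.Crystallization.Theorems.ThreeConeCertificateExactCertificateTransfer1DMaxGap
import Summits.AtomisticToContinuum.Crystallization.Theorems.ThreeConeCertificateExactCertificateTransfer1DLineConvex
import Literature.Probability.Percolation.InfiniteClusterDensityLimit
import Literature.NumberTheory.Sieve.MoebiusWalshCircuitsGreenProofs

/-!
# Crux `ExactCertificate` (stmt-AtomisticToContinuum-11959), line `closure-makes-nogap-exact`: TRANSFER THEOREM II —
# positional crystallization of the Lennard-Jones CHAIN and the whole sub-problem statement with `3 ↦ 1`

Support file (`--supports stmt-AtomisticToContinuum-11959`); nothing here closes the 3-D crux (`NoGap ∧ KeplerBound`,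
`KeplerBound` = item 11961 ↔ 0627, open).  Continuation of c6's Transfer exhibit (`…Transfer1D.lean`: `exactCertificate1D`,
`keplerBound1D`; `…Transfer1DEnergetic.lean`: `HasPeriodicGroundStateEnergy lennardJones 1`).  Proved here:
* `pos1d_groundState_structure` — STRUCTURE OF 1-D GROUND STATES, uniformly in `N`: sorted, all nearest-neighbour gaps lie in
  `[3/4, 1]` and `Σ_i (gap_i − a)² ≤ C` (`a` the zero-pressure lattice constant) — a d = 1 slack rigidity with O(1) slack;
* `isCrystallizing_lennardJones_one : IsCrystallizing lennardJones 1` (registered assembly stub `stub_isCrystallizing`): every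
  sequence of Lennard-Jones ground states on a line, recentred, converges locally to the chain `aℤ` (Blanc–Lewin 2015 (16)–(17);
  in print via Gardner–Radin 1979's analysis of finite ground states);
* `crystallization_lennardJones_one : HasPeriodicGroundStateEnergy lennardJones 1 ∧ IsCrystallizing lennardJones 1` — the summit
  sub-problem `Crystallization` with `3 ↦ 1`, verbatim otherwise (= the Transfer skeleton II decl `Crystallization1D`).

Mechanism — THE ROUTE'S METHOD (certificate ⇒ Kepler bound ⇒ O(1) slack ⇒ rigidity ⇒ local convergence): (1) BUDGET
`N·e_a ≤ E_N(x)` (`stub_keplerExplicit`) and `E_N(chain_a) ≤ N·e_a + C_a` (`stub_chainBudget`); (2) MINIMALITY BOX: ground-state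
gaps lie in `[3/4,1]` (`stub_lineMinGap`, `stub_lineMaxGap`); (3) UNIFORM CONVEXITY in gap coordinates on the box, midpoint form
(`stub_ljMidpointConvex`, `stub_lineEnergyConvex`), against the chain through `y_0` (`stub_aBounds`): `Σ_i (gap_i − a)² ≤ 2C_a`
(`pos1d_sq_sum_le`); (4) PIGEONHOLE (`stub_goodBlock`): `2M_N` consecutive gaps within `(M_N+1)⁻²` of `a`, `M_N = ⌊N^{1/8}⌋`;
(5) MATCHING (`stub_blockMatching`, `stub_chainPoints`) + uniform separation `3/4` + the tree's
`PeriodicConfiguration.tendsto_sum_of_eventually_near'` (`φ = id`, `τ_N = −x_{centre}`, `m ≡ 1`).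
-/

noncomputable section

namespace Summit.AtomisticToContinuum.Crystallization.Theorems.ThreeConeCertificateExactCertificate.Transfer1D

open Literature.MathematicalPhysics.StatisticalMechanics MeasureTheory Set Filter Topology
open scoped BigOperators

/-! ## Line-energy bookkeeping and the O(1) defect bound -/

/-- For an increasing configuration the absolute values in the line energy open up. [folklore] -/
theorem pos1d_sum_abs_eq (V : ℝ → ℝ) (N : ℕ) (y : ℕ → ℝ) (hy : ∀ i j : ℕ, i < j → j < N → y i < y j) :
    ∑ i ∈ Finset.range N, ∑ j ∈ Finset.Ico (i + 1) N, V (|y j - y i|) =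
      ∑ i ∈ Finset.range N, ∑ j ∈ Finset.Ico (i + 1) N, V (y j - y i) := by
  refine Finset.sum_congr rfl fun i _ => Finset.sum_congr rfl fun j hj => ?_
  rw [Finset.mem_Ico] at hj
  rw [abs_of_pos (sub_pos.2 (hy i j (by omega) hj.2))]

/-- The embedding `i ↦ (y i) e₀` of pairwise distinct reals is injective. [folklore] -/
theorem pos1d_embed_injective (N : ℕ) (y : ℕ → ℝ) (hy : ∀ i j : ℕ, i < j → j < N → y i ≠ y j) :
    Function.Injective (fun i : Fin N => EuclideanSpace.single (0 : Fin 1) (y i)) := by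
  intro i j h
  have h0 : y i = y j := by simpa using congrArg (fun v : EuclideanSpace ℝ (Fin 1) => v 0) h
  by_contra hne
  rcases Nat.lt_or_gt_of_ne (fun h' => hne (Fin.ext h')) with hlt | hlt
  · exact hy i j hlt j.2 h0
  · exact hy j i hlt i.2 h0.symm

/-- **Line minimality of a sorted ground state**: its line energy is the ground-state energy, and it is
minimal among all configurations of `N` distinct reals. [folklore] -/
theorem pos1d_lineMin {N : ℕ} {x : Fin N → EuclideanSpace ℝ (Fin 1)} (hx : IsGroundState lennardJones x)
    (σ : Equiv.Perm (Fin N)) (y : ℕ → ℝ)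
    (hyx : ∀ i : Fin N, x (σ i) = EuclideanSpace.single (0 : Fin 1) (y i)) :
    ∑ i ∈ Finset.range N, ∑ j ∈ Finset.Ico (i + 1) N, lennardJones (|y j - y i|) =
        interactionEnergy lennardJones x ∧
      ∀ y' : ℕ → ℝ, (∀ i j : ℕ, i < j → j < N → y' i ≠ y' j) →
        ∑ i ∈ Finset.range N, ∑ j ∈ Finset.Ico (i + 1) N, lennardJones (|y j - y i|) ≤
          ∑ i ∈ Finset.range N, ∑ j ∈ Finset.Ico (i + 1) N, lennardJones (|y' j - y' i|) := by
  have hE : ∑ i ∈ Finset.range N, ∑ j ∈ Finset.Ico (i + 1) N, lennardJones (|y j - y i|) =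
      interactionEnergy lennardJones x := by
    rw [← stub_lineSort.1 lennardJones N y]
    have hfun : (fun i : Fin N => EuclideanSpace.single (0 : Fin 1) (y i)) = x ∘ σ :=
      funext fun i => (hyx i).symm
    rw [hfun, interactionEnergy_comp_equiv]
  refine ⟨hE, fun y' hy' => ?_⟩
  rw [hE, hx.2, ← stub_lineSort.1 lennardJones N y']
  exact groundStateEnergy_lennardJones_le (pos1d_embed_injective N y' hy')

/-- The line energy of `N` equally spaced points (spacing `a`) is `Σ_{d<N} (N − d) V(da)`. [folklore] -/
theorem pos1d_chain_lineEnergy (a t : ℝ) (N : ℕ) :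
    ∑ i ∈ Finset.range N, ∑ j ∈ Finset.Ico (i + 1) N, lennardJones ((t + j * a) - (t + i * a)) =
      ∑ d ∈ Finset.range N, ((N : ℝ) - d) * lennardJones (d * a) := by
  have h := chainEnergy_sum_pairs (fun d : ℕ => lennardJones ((d : ℝ) * a)) (by simp [lennardJones_zero]) N
  have h2 := lineSort_sum_Ioi_eq_sum_range_Ico N (fun i j : ℕ => lennardJones (((j - i : ℕ) : ℝ) * a))
  beta_reduce at h h2
  rw [← h, h2]
  refine Finset.sum_congr rfl fun i _ => Finset.sum_congr rfl fun j hj => ?_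
  rw [Finset.mem_Ico] at hj
  rw [Nat.cast_sub (by omega)]
  ring_nf

/-- **The O(1) gap-defect bound** (budget + box + uniform convexity): for a sorted configuration `y`
of `N` reals with gaps in `[3/4, 1]`, minimal among configurations of distinct reals and with line
energy at least `N·e_a`, one has `Σ_{i<N−1} (a − gap_i)² ≤ 2C_a`. [folklore] -/
theorem pos1d_sq_sum_le {a eA C : ℝ} (ha34 : 3 / 4 ≤ a) (ha1 : a ≤ 1)
    (hC : ∀ N : ℕ, ∑ d ∈ Finset.range N, ((N : ℝ) - d) * lennardJones (d * a) ≤ N * eA + C)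
    (hD1 : (∀ s t : ℝ, 3 / 4 ≤ s → s ≤ 1 → 3 / 4 ≤ t → t ≤ 1 →
      lennardJones ((s + t) / 2) ≤ (lennardJones s + lennardJones t) / 2 - 3 / 4 * (s - t) ^ 2) ∧
      (∀ R s t : ℝ, 0 < R → R ≤ s → R ≤ t →
      lennardJones ((s + t) / 2) ≤ (lennardJones s + lennardJones t) / 2 + 7 / 8 * (R⁻¹) ^ 8 * (s - t) ^ 2))
    {N : ℕ} (y : ℕ → ℝ) (hy : ∀ i j : ℕ, i < j → j < N → y i < y j)
    (hmin : ∀ y' : ℕ → ℝ, (∀ i j : ℕ, i < j → j < N → y' i ≠ y' j) →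
      ∑ i ∈ Finset.range N, ∑ j ∈ Finset.Ico (i + 1) N, lennardJones (|y j - y i|) ≤
        ∑ i ∈ Finset.range N, ∑ j ∈ Finset.Ico (i + 1) N, lennardJones (|y' j - y' i|))
    (hkep : (N : ℝ) * eA ≤ ∑ i ∈ Finset.range N, ∑ j ∈ Finset.Ico (i + 1) N, lennardJones (|y j - y i|))
    (hlo : ∀ i : ℕ, i + 1 < N → 3 / 4 ≤ y (i + 1) - y i)
    (hhi : ∀ i : ℕ, i + 1 < N → y (i + 1) - y i ≤ 1) :
    ∑ i ∈ Finset.range (N - 1), (a - (y (i + 1) - y i)) ^ 2 ≤ 2 * C := by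
  -- the perfect chain through `y 0`
  set z : ℕ → ℝ := fun i => y 0 + i * a with hz
  have hzgap : ∀ i : ℕ, z (i + 1) - z i = a := fun i => by simp only [hz]; push_cast; ring
  have hzbox : ∀ i : ℕ, i + 1 < N → 3 / 4 ≤ z (i + 1) - z i ∧ z (i + 1) - z i ≤ 1 :=
    fun i _ => by rw [hzgap]; exact ⟨ha34, ha1⟩
  have hD := stub_lineEnergyConvex lennardJones hD1.1 hD1.2 N y z (fun i hi => ⟨hlo i hi, hhi i hi⟩) hzbox
  -- the midpoint configuration is increasing, hence an admissible competitor
  have ha0 : 0 < a := by linarith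
  have hzmono : ∀ i j : ℕ, i < j → j < N → z i < z j := fun i j hij _ => by
    simp only [hz]
    have : (i : ℝ) < j := by exact_mod_cast hij
    nlinarith
  have hm : ∀ i j : ℕ, i < j → j < N → (y i + z i) / 2 < (y j + z j) / 2 :=
    fun i j hij hjN => by linarith [hy i j hij hjN, hzmono i j hij hjN]
  have hmin' := hmin (fun i => (y i + z i) / 2) (fun i j hij hjN => (hm i j hij hjN).ne)
  rw [pos1d_sum_abs_eq _ _ _ hy] at hmin' hkep
  rw [pos1d_sum_abs_eq lennardJones N (fun i => (y i + z i) / 2) hm] at hmin'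
  -- the chain's line energy is within `C` of `N e_a`
  have hchain : ∑ i ∈ Finset.range N, ∑ j ∈ Finset.Ico (i + 1) N, lennardJones (z j - z i) ≤ N * eA + C := by
    have h := pos1d_chain_lineEnergy a (y 0) N
    simp only [hz]
    rw [h]
    exact hC N
  -- the defect sum of (D2) is `Σ (a − gap)²`
  have hS : ∑ i ∈ Finset.range (N - 1), ((z (i + 1) - z i) - (y (i + 1) - y i)) ^ 2 =
      ∑ i ∈ Finset.range (N - 1), (a - (y (i + 1) - y i)) ^ 2 :=
    Finset.sum_congr rfl fun i _ => by rw [hzgap]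
  rw [hS] at hD
  linarith

/-! ## The structure of one-dimensional Lennard-Jones ground states -/

/-- **STRUCTURE OF ONE-DIMENSIONAL LENNARD-JONES GROUND STATES (`pos1d_groundState_structure`).**
There are the zero-pressure lattice constant `a ∈ [3/4, 1]`, a constant `C`, and the chain `aℤ` (a periodic configuration of
`ℝ¹` with point set `{(ka)e₀}` enumerated by `ℤ`) such that EVERY ground state `x` of `N` Lennard-Jones particles on a line
is, after a relabelling `σ`, the embedding of a strictly increasing `y : ℕ → ℝ` all of whose nearest-neighbour gaps lie in
`[3/4, 1]` and satisfy `Σ_{i<N−1} (a − (y_{i+1} − y_i))² ≤ C` — uniformly in `N` (a d = 1 slack rigidity with O(1) slack). [folklore] -/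
theorem pos1d_groundState_structure : ∃ (a C : ℝ) (P : PeriodicConfiguration 1) (e : ℤ ≃ P.points),
    3 / 4 ≤ a ∧ a ≤ 1 ∧
    (∀ k : ℤ, ((e k : P.points) : EuclideanSpace ℝ (Fin 1)) = EuclideanSpace.single (0 : Fin 1) ((k : ℝ) * a)) ∧
    ∀ (N : ℕ) (x : Fin N → EuclideanSpace ℝ (Fin 1)), IsGroundState lennardJones x →
      ∃ (σ : Equiv.Perm (Fin N)) (y : ℕ → ℝ),
        (∀ i j : ℕ, i < j → j < N → y i < y j) ∧
        (∀ i : Fin N, x (σ i) = EuclideanSpace.single (0 : Fin 1) (y i)) ∧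
        (∀ i : ℕ, i + 1 < N → 3 / 4 ≤ y (i + 1) - y i) ∧
        (∀ i : ℕ, i + 1 < N → y (i + 1) - y i ≤ 1) ∧
        ∑ i ∈ Finset.range (N - 1), (a - (y (i + 1) - y i)) ^ 2 ≤ C := by
  -- constants: lattice constant `a ∈ [3/4,1]`, the chain `P = aℤ`, the budget `C`
  obtain ⟨a, ha, hz⟩ := zeroPressure_exists
  obtain ⟨ha34, ha1⟩ := stub_aBounds a ha hz
  obtain ⟨P, e, he⟩ := stub_chainPoints a ha
  obtain ⟨C₀, hC₀⟩ := stub_chainBudget a ha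
  set eA : ℝ := ∑' k : ℕ, lennardJones (((k : ℝ) + 1) * a) with heA
  set C : ℝ := max C₀ 0 with hCdef
  have hC : ∀ N : ℕ, ∑ d ∈ Finset.range N, ((N : ℝ) - d) * lennardJones (d * a) ≤ N * eA + C :=
    fun N => (hC₀ N).trans (by linarith [le_max_left C₀ 0])
  refine ⟨a, 2 * C, P, e, ha34, ha1, he, fun N x hx => ?_⟩
  -- sorting
  obtain ⟨σ, y, hymono, hyx⟩ := stub_lineSort.2 N x hx.1
  have hmin := (pos1d_lineMin hx σ y hyx).2
  -- the box
  have hlo : ∀ i : ℕ, i + 1 < N → 3 / 4 ≤ y (i + 1) - y i := stub_lineMinGap N y hymono hmin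
  have hhi : ∀ i : ℕ, i + 1 < N → y (i + 1) - y i ≤ 1 := stub_lineMaxGap N y hymono hmin
  -- the O(1) defect bound
  refine ⟨σ, y, hymono, hyx, hlo, hhi, ?_⟩
  refine pos1d_sq_sum_le ha34 ha1 hC stub_ljMidpointConvex y hymono hmin ?_ hlo hhi
  rw [(pos1d_lineMin hx σ y hyx).1]
  exact stub_keplerExplicit a ha hz N x hx.1

/-- **Registered stub `stub_isCrystallizing` — THE ASSEMBLY**: positional crystallization of the Lennard-Jones
chain, `IsCrystallizing lennardJones 1` (every sequence of ground states, recentred at the centre of a good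
block, converges locally to `Σ_{k∈ℤ} δ_{ka e₀}`; full sequence `φ = id`, multiplicity `m ≡ 1`). [folklore] -/
theorem stub_isCrystallizing : IsCrystallizing lennardJones 1 := by
  intro x hx
  -- the structure of ground states: lattice constant `a ∈ [3/4,1]`, chain `P = aℤ`, sorted positions `y N`, defect bound `C`
  obtain ⟨a, C, P, e, ha34, _ha1, he, hstruct⟩ := pos1d_groundState_structure
  have ha : 0 < a := by linarith
  have hstructN := fun N => hstruct N (x N) (hx N)
  choose σ y _hymono hyx hlo _hhi hsq using hstructN
  have hC0 : 0 ≤ C := (Finset.sum_nonneg fun i _ => sq_nonneg _).trans (hsq 0)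
  -- cumulative separation `|y j − y j'| ≥ ¾|j − j'|` (block matching with an empty block)
  have hsep0 : ∀ N, ∀ j j' : ℕ, j < N → j' < N → 3 / 4 * |(j : ℝ) - j'| ≤ |y N j - y N j'| := by
    intro N j j' hj hj'
    exact (stub_blockMatching N j' 0 (y N) a 0 (hlo N) (fun i hi hi' => by omega) (Nat.zero_le _)
      (by simpa using hj') le_rfl).1 j hj
  -- block parameters
  set M : ℕ → ℕ := fun N => Nat.sqrt (Nat.sqrt (Nat.sqrt N)) with hMdef
  set ε : ℕ → ℝ := fun N => 1 / ((M N : ℝ) + 1) ^ 2 with hεdef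
  have hεpos : ∀ N, 0 < ε N := fun N => by positivity
  have hMtend : Tendsto M atTop atTop :=
    Literature.Probability.Percolation.tendsto_nat_sqrt_atTop'.comp
      (Literature.Probability.Percolation.tendsto_nat_sqrt_atTop'.comp
        Literature.Probability.Percolation.tendsto_nat_sqrt_atTop')
  have hMtendR : Tendsto (fun N => (M N : ℝ)) atTop atTop := tendsto_natCast_atTop_atTop.comp hMtend
  -- good `N`: the pigeonhole applies with block length `2 M_N`
  have hgood : ∀ᶠ N in atTop, (C / ε N ^ 2 + 2) * ((2 * M N : ℕ) : ℝ) ≤ ((N - 1 : ℕ) : ℝ) := by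
    filter_upwards [hMtendR.eventually_ge_atTop (64 * C + 5), Filter.eventually_ge_atTop 1] with N hN hN1
    have hm1 : (1 : ℝ) ≤ M N := by linarith
    have hm0 : (0 : ℝ) ≤ M N := by linarith
    have hM8 : (M N : ℝ) ^ 8 ≤ N := by exact_mod_cast Literature.NumberTheory.Sieve.GreenAC0.kk_pow_le N
    have hεN : ε N ^ 2 = 1 / ((M N : ℝ) + 1) ^ 4 := by
      simp only [hεdef]
      rw [div_pow, one_pow, ← pow_mul]
    have hdiv : C / (1 / ((M N : ℝ) + 1) ^ 4) = C * ((M N : ℝ) + 1) ^ 4 := by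
      field_simp
    rw [hεN, hdiv, Nat.cast_sub hN1, Nat.cast_mul]
    push_cast
    have h16 : ((M N : ℝ) + 1) ^ 4 ≤ 16 * (M N : ℝ) ^ 4 := by
      have h2 : (M N : ℝ) + 1 ≤ 2 * M N := by linarith
      calc ((M N : ℝ) + 1) ^ 4 ≤ (2 * (M N : ℝ)) ^ 4 := pow_le_pow_left₀ (by linarith) h2 4
        _ = 16 * (M N : ℝ) ^ 4 := by ring
    have h4 : (1 : ℝ) ≤ (M N : ℝ) ^ 4 := one_le_pow₀ hm1
    have h5 : (M N : ℝ) ≤ (M N : ℝ) ^ 5 := le_self_pow₀ hm1 (by norm_num)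
    have hA : (C * ((M N : ℝ) + 1) ^ 4 + 2) * (2 * (M N : ℝ)) ≤ (32 * C + 4) * (M N : ℝ) ^ 5 := by
      have h1 : C * ((M N : ℝ) + 1) ^ 4 ≤ 16 * C * (M N : ℝ) ^ 4 := by nlinarith
      nlinarith
    have hB : (32 * C + 4) * (M N : ℝ) ^ 5 ≤ (M N : ℝ) ^ 8 - 1 := by
      have h1 : (64 * C + 5) * (M N : ℝ) ^ 5 ≤ (M N : ℝ) ^ 8 := by
        have h3 : 64 * C + 5 ≤ (M N : ℝ) ^ 3 := by
          calc 64 * C + 5 ≤ (M N : ℝ) := hN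
            _ ≤ (M N : ℝ) ^ 3 := le_self_pow₀ hm1 (by norm_num)
        calc (64 * C + 5) * (M N : ℝ) ^ 5 ≤ (M N : ℝ) ^ 3 * (M N : ℝ) ^ 5 :=
              mul_le_mul_of_nonneg_right h3 (by positivity)
          _ = (M N : ℝ) ^ 8 := by ring
      have h5' : (1 : ℝ) ≤ (M N : ℝ) ^ 5 := one_le_pow₀ hm1
      nlinarith
    linarith
  -- the centre of a good block (or `0` when there is none)
  have hblockEx : ∀ N, (C / ε N ^ 2 + 2) * ((2 * M N : ℕ) : ℝ) ≤ ((N - 1 : ℕ) : ℝ) →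
      ∃ s : ℕ, s + 2 * M N ≤ N - 1 ∧ ∀ i : ℕ, s ≤ i → i < s + 2 * M N → |a - (y N (i + 1) - y N i)| ≤ ε N :=
    fun N hN => stub_goodBlock (N - 1) (2 * M N) (fun i => a - (y N (i + 1) - y N i)) C (ε N) (hεpos N) (hsq N) hN
  classical
  let c : ℕ → ℕ := fun N =>
    if h : (C / ε N ^ 2 + 2) * ((2 * M N : ℕ) : ℝ) ≤ ((N - 1 : ℕ) : ℝ) then Classical.choose (hblockEx N h) + M N else 0
  have hc : ∀ N, 1 ≤ N → (hN : (C / ε N ^ 2 + 2) * ((2 * M N : ℕ) : ℝ) ≤ ((N - 1 : ℕ) : ℝ)) →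
      M N ≤ c N ∧ c N + M N < N ∧
      (∀ i : ℕ, c N - M N ≤ i → i < c N + M N → |y N (i + 1) - y N i - a| ≤ ε N) := by
    intro N hN1 hN
    have hcN : c N = Classical.choose (hblockEx N hN) + M N := by simp only [c, dif_pos hN]
    obtain ⟨hs1, hs2⟩ := Classical.choose_spec (hblockEx N hN)
    refine ⟨by rw [hcN]; exact Nat.le_add_left _ _, by rw [hcN]; omega, fun i hi1 hi2 => ?_⟩
    rw [abs_sub_comm]
    exact hs2 i (by rw [hcN] at hi1; omega) (by rw [hcN] at hi2; omega)
  -- translations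
  let τ : ℕ → EuclideanSpace ℝ (Fin 1) := fun N => -EuclideanSpace.single (0 : Fin 1) (y N (c N))
  -- coordinates of the translated particles
  have hcoord : ∀ N (i : Fin N), (x N i + τ N) 0 = y N ((σ N).symm i) - y N (c N) := by
    intro N i
    have h1 : x N i = EuclideanSpace.single (0 : Fin 1) (y N ((σ N).symm i)) := by
      rw [← hyx N ((σ N).symm i), Equiv.apply_symm_apply]
    rw [h1]
    simp [τ, sub_eq_add_neg]
  refine ⟨id, τ, P, fun _ => 1, strictMono_id, fun _ _ => le_rfl, fun _ _ _ => rfl, fun f hfc hf => ?_⟩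
  refine P.tendsto_sum_of_eventually_near' (n := id) (fun N i => x N i + τ N) (δ := 3 / 4) (by norm_num)
    ?_ ?_ hfc hf
  · -- uniform separation `3/4`
    intro N i i' hii'
    rw [StickyChain.dist_eq_abs_sub, hcoord, hcoord, sub_sub_sub_cancel_right]
    have hne : ((σ N).symm i : ℕ) ≠ ((σ N).symm i' : ℕ) := fun h =>
      hii' ((σ N).symm.injective (Fin.ext h))
    have h1 := hsep0 N ((σ N).symm i) ((σ N).symm i') ((σ N).symm i).2 ((σ N).symm i').2
    have h2 : (1 : ℝ) ≤ |((((σ N).symm i : ℕ) : ℝ)) - (((σ N).symm i' : ℕ) : ℝ)| := by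
      have hz0 : (((σ N).symm i : ℕ) : ℤ) - (((σ N).symm i' : ℕ) : ℤ) ≠ 0 := by omega
      have h3 := Int.one_le_abs hz0
      have h4 : ((1 : ℤ) : ℝ) ≤ ((|(((σ N).symm i : ℕ) : ℤ) - (((σ N).symm i' : ℕ) : ℤ)| : ℤ) : ℝ) := by
        exact_mod_cast h3
      rw [Int.cast_one, Int.cast_abs, Int.cast_sub, Int.cast_natCast, Int.cast_natCast] at h4
      exact h4
    nlinarith
  · -- two-way `ε₀`-matching with `aℤ` on the ball of radius `R`, eventually
    intro R ε₀ hε₀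
    filter_upwards [hgood, hMtendR.eventually_ge_atTop (4 / 3 * max R 0 + 1 / ε₀ + 2),
      Filter.eventually_ge_atTop 1] with N hN hMN hN1
    obtain ⟨hMc, hcM, hblk⟩ := hc N hN1 hN
    obtain ⟨hfar, hnear⟩ :=
      stub_blockMatching N (c N) (M N) (y N) a (ε N) (hlo N) hblk hMc hcM (hεpos N).le
    have hR0 : R ≤ max R 0 := le_max_left _ _
    have hmax0 : 0 ≤ max R 0 := le_max_right _ _
    have hε0' : 0 < 1 / ε₀ := by positivity
    -- `M ε ≤ ε₀`
    have hMε : (M N : ℝ) * ε N ≤ ε₀ := by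
      have hM1 : 1 / ε₀ ≤ (M N : ℝ) + 1 := by linarith
      have h1 : 1 ≤ ε₀ * ((M N : ℝ) + 1) := by
        rw [div_le_iff₀ hε₀] at hM1
        linarith
      simp only [hεdef]
      rw [mul_one_div, div_le_iff₀ (by positivity)]
      nlinarith [(Nat.cast_nonneg (M N) : (0 : ℝ) ≤ M N)]
    have hMR : 4 / 3 * max R 0 + 1 ≤ (M N : ℝ) := by linarith
    constructor
    · -- every site `(k a) e₀` with `|k a| ≤ R` has a particle within `ε₀`: the particle of rank `c + k`
      intro s hs hsR
      obtain ⟨k, hk⟩ := e.surjective ⟨s, hs⟩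
      have hsk : s = EuclideanSpace.single (0 : Fin 1) ((k : ℝ) * a) := by
        have h1 := he k
        rw [hk] at h1
        exact h1
      have hkabs : |(k : ℝ)| ≤ M N := by
        rw [hsk, StickyChain.norm_eq_abs] at hsR
        simp only [PiLp.single_apply, if_true, abs_mul, abs_of_pos ha] at hsR
        have h1 : |(k : ℝ)| ≤ R / a := (le_div_iff₀ ha).2 hsR
        have h2 : R / a ≤ max R 0 / (3 / 4) := by
          calc R / a ≤ max R 0 / a := div_le_div_of_nonneg_right hR0 ha.le
            _ ≤ max R 0 / (3 / 4) := div_le_div_of_nonneg_left hmax0 (by norm_num) ha34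
        linarith
      obtain ⟨hk1, hk2⟩ := abs_le.1 hkabs
      have hk1' : -(M N : ℤ) ≤ k := by exact_mod_cast hk1
      have hk2' : k ≤ (M N : ℤ) := by exact_mod_cast hk2
      obtain ⟨j, hj⟩ : ∃ j : ℕ, (j : ℤ) = (c N : ℤ) + k :=
        ⟨Int.toNat ((c N : ℤ) + k), Int.toNat_of_nonneg (by omega)⟩
      have hjN : j < N := by omega
      have hjR : (j : ℝ) - c N = k := by
        have h1 : ((j : ℤ) : ℝ) = (((c N : ℤ) + k : ℤ) : ℝ) := by rw [hj]
        push_cast at h1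
        linarith
      refine ⟨σ N ⟨j, hjN⟩, ?_⟩
      rw [StickyChain.dist_eq_abs_sub, hcoord, Equiv.symm_apply_apply, hsk]
      simp only [PiLp.single_apply, if_true]
      have h1 := hnear j (by omega) (by omega)
      rw [hjR] at h1
      exact h1.trans hMε
    · -- every particle within `R` of the centre sits in the block and has its site within `ε₀`
      intro i hi
      rw [StickyChain.norm_eq_abs, hcoord] at hi
      set j : ℕ := ((σ N).symm i : ℕ) with hjdef
      have hjN : j < N := ((σ N).symm i).2
      have hjblk : c N - M N ≤ j ∧ j ≤ c N + M N := by
        by_contra hout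
        have hfj := hfar j hjN
        have hout' : (M N : ℝ) + 1 ≤ |(j : ℝ) - c N| := by
          rcases not_and_or.1 hout with h | h
          · have h' : j + M N + 1 ≤ c N := by omega
            have h'' : (j : ℝ) + M N + 1 ≤ c N := by exact_mod_cast h'
            rw [abs_sub_comm, abs_of_nonneg (by linarith)]
            linarith
          · have h' : c N + M N + 1 ≤ j := by omega
            have h'' : (c N : ℝ) + M N + 1 ≤ j := by exact_mod_cast h'
            rw [abs_of_nonneg (by linarith)]
            linarith
        have : R < |y N j - y N (c N)| := by
          calc R ≤ max R 0 := hR0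
            _ < 3 / 4 * ((M N : ℝ) + 1) := by linarith
            _ ≤ 3 / 4 * |(j : ℝ) - c N| := by gcongr
            _ ≤ |y N j - y N (c N)| := hfj
        linarith
      refine ⟨(e ((j : ℤ) - c N) : EuclideanSpace ℝ (Fin 1)), (e _).2, ?_⟩
      rw [StickyChain.dist_eq_abs_sub, hcoord, he]
      simp only [PiLp.single_apply, if_true]
      have h1 := hnear j hjblk.1 hjblk.2
      push_cast
      exact h1.trans hMε

/-- **POSITIONAL CRYSTALLIZATION OF THE LENNARD-JONES CHAIN**: `IsCrystallizing lennardJones 1` (= the registered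
assembly stub `stub_isCrystallizing` of the Transfer skeleton II). [folklore] -/
theorem isCrystallizing_lennardJones_one : IsCrystallizing lennardJones 1 :=
  stub_isCrystallizing

/-- **CRYSTALLIZATION OF THE LENNARD-JONES CHAIN** — the summit sub-problem `Crystallization` with `3 ↦ 1`, verbatim otherwise
(`HasPeriodicGroundStateEnergy lennardJones 1 ∧ IsCrystallizing lennardJones 1`): the ground-state energy per particle converges
to the attained periodic minimum `e(aℤ)`, and ground states converge locally, up to translations, to the chain `aℤ`
(Ventevogel 1978 / Gardner–Radin 1979; here by the certificate method of route ThreeConeCertificate). [folklore] -/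
theorem crystallization_lennardJones_one :
    HasPeriodicGroundStateEnergy lennardJones 1 ∧ IsCrystallizing lennardJones 1 :=
  ⟨hasPeriodicGroundStateEnergy_lennardJones_one, stub_isCrystallizing⟩

end Summit.AtomisticToContinuum.Crystallization.Theorems.ThreeConeCertificateExactCertificate.Transfer1D

end
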